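import Literature.NumberTheory.EllipticCurves.HeckeOperatorsGamma1QExpansionProofs
import Literature.NumberTheory.EllipticCurves.HeckeOperatorsProofs
import HarnessLib

/-!
# The operator `U_M` lowering the level from `Γ₁(LM)` to `Γ₁(L)` (`M ∣ L`)

Topic `Literature/NumberTheory/EllipticCurves`; namespace
`Literature.NumberTheory.EllipticCurves.ModularForms` (helpers in the sub-namespace `ULower`).
THEOREMS and auxiliary definitions (`uLevel`, `uLower`, the matrices `ULower.gammaU`, `ULower.gammaD`); no named fact.  The matrices `βⱼ = tpB M j = (1 j; 0 M)`, `tpG M = diag(1, M)`, `tpD M = diag(M, 1)` are those of `HeckeOperatorsProofs`.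

For a prime `M`, a level `L` with `M ∣ L`, a weight `k` and a modular form `f ∈ M_k(Γ₁(LM))` which
is `Γ₀(LM)`-equivariant with a character `χ` of modulus `N ∣ L`
(`f ∣[k] γ = χ(d_γ) f`), the function

  `U_M f = ∑_{j mod M} f ∣[k] (1 j; 0 M)`

is a modular form of weight `k` on `Γ₁(L)` (`uLower`), again `Γ₀(L)`-equivariant with `χ`
(`uLower_slash_of_mem_gamma0`), with `q`-expansion `aₙ(U_M f) = a_{Mn}(f)`
(`qExpansion_coeff_uLower`) — the classical level-lowering property of `U_M` when `M²` divides
the level and the character is defined modulo the level divided by `M` (Atkin–Lehner 1970,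
Lemma 7 / Li 1975, Lemma 1; Diamond–Shurman §5.2 for the coset computation
`(1 j; 0 M)(a b; c d) = γ' (1 j'; 0 M)`).  Its constant terms along `SL₂(ℤ)` are computed in
`ULower.tendsto_sum_slash_tpB_atImInfty`: if `f ∣[k] γ → e χ(d_γ) [N ∣ c_γ, M ∤ c_γ]` for all
`γ`, then `U_M f ∣[k] γ → M^{k-1} χ(M) e χ(d_γ) [N ∣ c_γ, M ∤ c_γ]`.

## References

* A. O. L. Atkin, J. Lehner, *Hecke operators on `Γ₀(m)`*, Math. Ann. 185 (1970), 134–160,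
  Lemma 7. [AtkinLehner1970]
* F. Diamond, J. Shurman, *A First Course in Modular Forms*, GTM 228 (2005), §5.2
  (Prop. 5.2.1, (5.2)). [DiamondShurman2005]
-/

noncomputable section

open scoped MatrixGroups ModularForm Real Topology

open ConjAct Pointwise CongruenceSubgroup Matrix.SpecialLinearGroup Complex ModularGroup Filter
open UpperHalfPlane hiding I
open Function hiding eval

namespace Literature.NumberTheory.EllipticCurves.ModularForms

namespace ULower

open HeckeTGamma1

variable (M : ℕ) [NeZero M]

/-- `det βⱼ = M > 0` (`βⱼ = tpB M j = (1 j; 0 M)` of `HeckeOperatorsProofs`). [folklore] -/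
theorem det_tpB_pos (j : ℤ) : 0 < ((tpB M j : GL (Fin 2) ℝ).det.val : ℝ) := by
  rw [det_tpB]
  exact Nat.cast_pos.mpr (NeZero.pos M)

/-- Scalars pass through slashing by `βⱼ` (positive determinant). [folklore] -/
theorem smul_slash_tpB (k : ℤ) (f : ℍ → ℂ) (c : ℂ) (j : ℤ) :
    (c • f) ∣[k] tpB M j = c • f ∣[k] tpB M j := by
  rw [ModularForm.smul_slash, σ, if_pos (det_tpB_pos M j)]
  rfl

/-! ### The coset identity `βⱼ γ = γ' β_{j'}` for `M ∣ c_γ` -/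

omit [NeZero M] in
/-- For `γ = (a b; c d) ∈ SL₂(ℤ)` with `M ∣ c`, `M ∤ a + jc`. [folklore] -/
theorem not_dvd_add_mul (hM : M.Prime) {γ : SL(2, ℤ)} (hc : (M : ℤ) ∣ γ 1 0) (j : ℤ) :
    ¬ (M : ℤ) ∣ γ 0 0 + j * γ 1 0 := by
  intro h
  have hdet := Matrix.SpecialLinearGroup.det_coe γ
  rw [Matrix.det_fin_two] at hdet
  have ha : (M : ℤ) ∣ γ 0 0 := by
    have := dvd_sub h (dvd_mul_of_dvd_right hc j)
    simpa using this
  have h1 : (M : ℤ) ∣ 1 := by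
    rw [← hdet]
    exact dvd_sub (dvd_mul_of_dvd_left ha _) (dvd_mul_of_dvd_right hc _)
  exact hM.one_lt.ne' (by exact_mod_cast Int.eq_one_of_dvd_one (by positivity) h1)

/-- The matrix `γ' = (a + jc, e; Mc, d - j'c)` of the coset identity, for integers with
`M e = b + jd - j'(a + jc)`. [folklore] -/
def gammaU (γ : SL(2, ℤ)) (j j' e : ℤ) (he : (M : ℤ) * e = γ 0 1 + j * γ 1 1 - j' * (γ 0 0 + j * γ 1 0)) :
    SL(2, ℤ) :=
  ⟨!![γ 0 0 + j * γ 1 0, e; (M : ℤ) * γ 1 0, γ 1 1 - j' * γ 1 0], by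
    have hdet := Matrix.SpecialLinearGroup.det_coe γ
    rw [Matrix.det_fin_two] at hdet
    rw [Matrix.det_fin_two_of]
    linear_combination hdet - (γ 1 0) * he⟩

/-- **The coset identity** `βⱼ γ = γ' β_{j'}` in `GL₂(ℝ)`. [cite: DiamondShurman2005, §5.2 p. 170] -/
theorem tpB_mul_eq (γ : SL(2, ℤ)) (j j' e : ℤ)
    (he : (M : ℤ) * e = γ 0 1 + j * γ 1 1 - j' * (γ 0 0 + j * γ 1 0)) :
    tpB M j * (γ : GL (Fin 2) ℝ) = (gammaU M γ j j' e he : GL (Fin 2) ℝ) * tpB M j' := by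
  ext i i'
  have he' : (M : ℝ) * e = γ 0 1 + j * γ 1 1 - j' * (γ 0 0 + j * γ 1 0) := by exact_mod_cast he
  rw [Matrix.GeneralLinearGroup.coe_mul, Matrix.GeneralLinearGroup.coe_mul, val_tpB, val_tpB]
  simp only [gammaU]
  fin_cases i <;> fin_cases i' <;>
    simp [Matrix.mul_apply, Fin.sum_univ_two] <;>
      first | ring1 | linear_combination -he'

/-! ### The reindexing `j ↦ j'` and the `Γ₀(L)`-equivariance of `U_M` -/

section Level

variable {M}

omit [NeZero M] in
/-- The index `j'` of the coset identity exists (`a + jc` is a unit modulo `M`). [folklore] -/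
theorem exists_fin_coset (hM : M.Prime) {γ : SL(2, ℤ)} (hc : (M : ℤ) ∣ γ 1 0) (j : Fin M) :
    ∃ j' : Fin M, (M : ℤ) ∣ (γ 0 1 + ((j : ℕ) : ℤ) * γ 1 1) -
      ((j' : ℕ) : ℤ) * (γ 0 0 + ((j : ℕ) : ℤ) * γ 1 0) :=
  exists_fin_dvd_sub_mul hM (not_dvd_add_mul M hM hc _) _

/-- **The reindexing `j ↦ j'`** of the cosets `Γ₁ βⱼ` under right multiplication by `γ`
(`M ∣ c_γ`). [folklore] -/
def sigmaU (hM : M.Prime) {γ : SL(2, ℤ)} (hc : (M : ℤ) ∣ γ 1 0) (j : Fin M) : Fin M :=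
  (exists_fin_coset hM hc j).choose

omit [NeZero M] in
/-- The defining divisibility of `j' = sigmaU j`. [folklore] -/
theorem sigmaU_spec (hM : M.Prime) {γ : SL(2, ℤ)} (hc : (M : ℤ) ∣ γ 1 0) (j : Fin M) :
    (M : ℤ) ∣ (γ 0 1 + ((j : ℕ) : ℤ) * γ 1 1) -
      ((sigmaU hM hc j : ℕ) : ℤ) * (γ 0 0 + ((j : ℕ) : ℤ) * γ 1 0) :=
  (exists_fin_coset hM hc j).choose_spec

omit [NeZero M] in
/-- `j ↦ j'` is a bijection of `ℤ/Mℤ` (`d_γ` is a unit modulo `M`). [folklore] -/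
theorem sigmaU_bijective (hM : M.Prime) {γ : SL(2, ℤ)} (hc : (M : ℤ) ∣ γ 1 0) :
    Function.Bijective (sigmaU hM hc) := by
  refine (Finite.injective_iff_bijective).mp fun j₁ j₂ h ↦ ?_
  have h1 := sigmaU_spec hM hc j₁
  have h2 := sigmaU_spec hM hc j₂
  rw [h] at h1
  have hpz : Prime (M : ℤ) := Nat.prime_iff_prime_int.mp hM
  have hdet := Matrix.SpecialLinearGroup.det_coe γ
  rw [Matrix.det_fin_two] at hdet
  have hd : ¬ (M : ℤ) ∣ γ 1 1 := by
    intro hd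
    have : (M : ℤ) ∣ 1 := by
      rw [← hdet]
      exact dvd_sub (dvd_mul_of_dvd_right hd _) (dvd_mul_of_dvd_right hc _)
    exact hM.one_lt.ne' (by exact_mod_cast Int.eq_one_of_dvd_one (by positivity) this)
  -- `M ∣ (j₁ - j₂)(d - j' c)`
  have h3 : (M : ℤ) ∣ (((j₁ : ℕ) : ℤ) - ((j₂ : ℕ) : ℤ)) * γ 1 1 := by
    have h4 := dvd_sub h1 h2
    have h5 : (M : ℤ) ∣ (((j₁ : ℕ) : ℤ) - ((j₂ : ℕ) : ℤ)) * ((sigmaU hM hc j₂ : ℕ) : ℤ) * γ 1 0 :=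
      dvd_mul_of_dvd_right hc _
    have := dvd_add h4 h5
    have e : γ 0 1 + ((j₁ : ℕ) : ℤ) * γ 1 1 -
        ((sigmaU hM hc j₂ : ℕ) : ℤ) * (γ 0 0 + ((j₁ : ℕ) : ℤ) * γ 1 0) -
        (γ 0 1 + ((j₂ : ℕ) : ℤ) * γ 1 1 -
          ((sigmaU hM hc j₂ : ℕ) : ℤ) * (γ 0 0 + ((j₂ : ℕ) : ℤ) * γ 1 0)) +
        (((j₁ : ℕ) : ℤ) - ((j₂ : ℕ) : ℤ)) * ((sigmaU hM hc j₂ : ℕ) : ℤ) * γ 1 0 =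
        (((j₁ : ℕ) : ℤ) - ((j₂ : ℕ) : ℤ)) * γ 1 1 := by ring
    rwa [e] at this
  have h6 : (M : ℤ) ∣ ((j₁ : ℕ) : ℤ) - ((j₂ : ℕ) : ℤ) := (hpz.dvd_or_dvd h3).resolve_right hd
  have h7 : (((j₁ : ℕ) : ℤ) - ((j₂ : ℕ) : ℤ)) = 0 := by
    refine Int.eq_zero_of_abs_lt_dvd h6 ?_
    have hj1 := j₁.2
    have hj2 := j₂.2
    rw [abs_lt]
    constructor <;> omega
  exact Fin.ext (by omega)

/-- **`U_M` is `Γ₀(L)`-equivariant** (`M ∣ L`): if `f ∣[k] γ = χ(d_γ) f` for all `γ ∈ Γ₀(LM)`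
(`χ` modulo `N ∣ L`), then `(∑ⱼ f ∣[k] βⱼ) ∣[k] γ = χ(d_γ) ∑ⱼ f ∣[k] βⱼ` for all `γ ∈ Γ₀(L)`
(Atkin–Lehner 1970, Lemma 7; the cosets `Γ₁ βⱼ γ = Γ₁ β_{j'}`).
[cite: AtkinLehner1970, Lemma 7] [cite: DiamondShurman2005, §5.2 p. 170] -/
theorem sum_slash_tpB_slash (hM : M.Prime) {L N : ℕ} (hML : M ∣ L) (hNL : N ∣ L)
    (χ : DirichletCharacter ℂ N) (k : ℤ) (f : ℍ → ℂ)
    (hf : ∀ γ : SL(2, ℤ), γ ∈ Gamma0 (L * M) → f ∣[k] γ = χ ((γ 1 1 : ℤ) : ZMod N) • f)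
    {γ : SL(2, ℤ)} (hγ : γ ∈ Gamma0 L) :
    (∑ j : Fin M, f ∣[k] tpB M ((j : ℕ) : ℤ)) ∣[k] (γ : GL (Fin 2) ℝ) =
      χ ((γ 1 1 : ℤ) : ZMod N) • ∑ j : Fin M, f ∣[k] tpB M ((j : ℕ) : ℤ) := by
  haveI : NeZero M := ⟨hM.ne_zero⟩
  have hLc : (L : ℤ) ∣ γ 1 0 := by
    have h := Gamma0_mem.mp hγ
    rwa [ZMod.intCast_zmod_eq_zero_iff_dvd] at h
  have hc : (M : ℤ) ∣ γ 1 0 := (Int.natCast_dvd_natCast.mpr hML).trans hLc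
  have hNc : (N : ℤ) ∣ γ 1 0 := (Int.natCast_dvd_natCast.mpr hNL).trans hLc
  -- each term
  have hterm : ∀ j : Fin M, (f ∣[k] tpB M ((j : ℕ) : ℤ)) ∣[k] (γ : GL (Fin 2) ℝ) =
      χ ((γ 1 1 : ℤ) : ZMod N) • f ∣[k] tpB M ((sigmaU hM hc j : ℕ) : ℤ) := by
    intro j
    obtain ⟨e, he⟩ := sigmaU_spec hM hc j
    have he' : (M : ℤ) * e = γ 0 1 + ((j : ℕ) : ℤ) * γ 1 1 -
        ((sigmaU hM hc j : ℕ) : ℤ) * (γ 0 0 + ((j : ℕ) : ℤ) * γ 1 0) := he.symm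
    set γ' := gammaU M γ ((j : ℕ) : ℤ) ((sigmaU hM hc j : ℕ) : ℤ) e he' with hγ'
    have hmem : γ' ∈ Gamma0 (L * M) := by
      rw [Gamma0_mem, ZMod.intCast_zmod_eq_zero_iff_dvd]
      change ((L * M : ℕ) : ℤ) ∣ (M : ℤ) * γ 1 0
      push_cast
      rw [mul_comm (L : ℤ)]
      exact mul_dvd_mul_left _ hLc
    have h11 : χ ((γ' 1 1 : ℤ) : ZMod N) = χ ((γ 1 1 : ℤ) : ZMod N) := by
      change χ (((γ 1 1 - ((sigmaU hM hc j : ℕ) : ℤ) * γ 1 0 : ℤ)) : ZMod N) = _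
      congr 1
      push_cast
      obtain ⟨t, ht⟩ := hNc
      rw [ht]
      push_cast
      rw [ZMod.natCast_self, zero_mul, mul_zero, sub_zero]
    rw [← SlashAction.slash_mul, tpB_mul_eq M γ _ _ e he', SlashAction.slash_mul, ← hγ',
      ← ModularForm.SL_slash, hf γ' hmem, h11, smul_slash_tpB]
  rw [SlashAction.sum_slash]
  simp_rw [hterm]   -- may need Finset.sum_congr
  rw [← Finset.smul_sum]
  congr 1
  exact Fintype.sum_bijective _ (sigmaU_bijective hM hc) _ _ fun j ↦ rfl

end Level

end ULower

open ULower HeckeTGamma1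

/-! ### `U_M` as a modular form: at level `Γ₁(LM)` and, lowered, at level `Γ₁(L)` -/

section Operator

variable (L M : ℕ) [NeZero L] [NeZero M] (k : ℤ)

/-- **`U_M` at level `Γ₁(LM)`**: the Hecke operator `T_M = [Γ₁(LM) diag(1, M) Γ₁(LM)]_k`
(`M` divides the level). [cite: DiamondShurman2005, Prop. 5.2.1 p. 171] -/
def uLevel (f : ModularForm (Gamma1 (L * M)) k) : ModularForm (Gamma1 (L * M)) k :=
  heckeOperator (Gamma1 (L * M)) k
    ((diagGL 1 (M : ℚ) one_pos (Nat.cast_pos.mpr (NeZero.pos M)) : GL(2, ℚ)⁺) : GL (Fin 2) ℚ) f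

/-- **`U_M f = ∑_{j mod M} f ∣[k] (1 j; 0 M)`** at level `Γ₁(LM)` (Diamond–Shurman Prop. 5.2.1,
case `p ∣ N`). [cite: DiamondShurman2005, Prop. 5.2.1 p. 171] -/
theorem coe_uLevel (hM : M.Prime) (f : ModularForm (Gamma1 (L * M)) k) :
    (⇑(uLevel L M k f) : ℍ → ℂ) = ∑ j : Fin M, ⇑f ∣[k] tpB M ((j : ℕ) : ℤ) :=
  coe_heckeOperator_eq_sum_slash_of_cosetReps (Gamma1 (L * M)) k _
    (fun j : Fin M ↦ mapGL ℝ (T ^ ((j : ℕ) : ℤ)))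
    (fun _ ↦ Subgroup.mem_map_of_mem _ (T_zpow_mem_Gamma1 (L * M) _))
    (existsUnique_fin_of_dvd_level (L * M) hM (dvd_mul_left M L) (val_tpG M)) f

variable {L M k}

/-- **The level-lowering operator `U_M : M_k(Γ₁(LM)) → M_k(Γ₁(L))`** on forms which are
`Γ₀(LM)`-equivariant with a character modulo `N ∣ L` (`M` prime, `M ∣ L`): the function
`∑ⱼ f ∣[k] (1 j; 0 M)`, invariant under `Γ₁(L)` by `ULower.sum_slash_tpB_slash`, holomorphic
and bounded at all cusps because it is the modular form `uLevel f` of level `Γ₁(LM)`.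
[cite: AtkinLehner1970, Lemma 7] -/
def uLower (hM : M.Prime) (hML : M ∣ L) {N : ℕ} [NeZero N] (hNL : N ∣ L)
    (χ : DirichletCharacter ℂ N) (f : ModularForm (Gamma1 (L * M)) k)
    (hf : ∀ γ : SL(2, ℤ), γ ∈ Gamma0 (L * M) → (⇑f : ℍ → ℂ) ∣[k] γ = χ ((γ 1 1 : ℤ) : ZMod N) • ⇑f) :
    ModularForm (Gamma1 L) k where
  toFun := ⇑(uLevel L M k f)
  slash_action_eq' := by
    rintro _ ⟨γ, hγ, rfl⟩
    change (⇑(uLevel L M k f) : ℍ → ℂ) ∣[k] ((γ : SL(2, ℤ)) : GL (Fin 2) ℝ) = ⇑(uLevel L M k f)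
    have hγ0 : γ ∈ Gamma0 L := Gamma1_in_Gamma0 L hγ
    have h11 : χ ((γ 1 1 : ℤ) : ZMod N) = 1 := by
      have h1 := ((Gamma1_mem L γ).mp hγ).2.1
      have h2 := congrArg (ZMod.castHom hNL (ZMod N)) h1
      rw [map_intCast, map_one] at h2
      rw [h2, map_one]
    rw [coe_uLevel L M k hM f, sum_slash_tpB_slash hM hML hNL χ k ⇑f hf hγ0, h11, one_smul]
  holo' := (uLevel L M k f).holo'
  bdd_at_cusps' {c} hc γ hγ := by
    rw [Subgroup.IsArithmetic.isCusp_iff_isCusp_SL2Z] at hc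
    have hc' : IsCusp c (Gamma1 (L * M) : Subgroup (GL (Fin 2) ℝ)) :=
      (Subgroup.IsArithmetic.isCusp_iff_isCusp_SL2Z _).mpr hc
    exact ModularFormClass.bdd_at_cusps (uLevel L M k f) hc' γ hγ

/-- `U_M f` as a function: `∑ⱼ f ∣[k] (1 j; 0 M)`. [folklore] -/
theorem coe_uLower (hM : M.Prime) (hML : M ∣ L) {N : ℕ} [NeZero N] (hNL : N ∣ L)
    (χ : DirichletCharacter ℂ N) (f : ModularForm (Gamma1 (L * M)) k)
    (hf : ∀ γ : SL(2, ℤ), γ ∈ Gamma0 (L * M) → (⇑f : ℍ → ℂ) ∣[k] γ = χ ((γ 1 1 : ℤ) : ZMod N) • ⇑f) :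
    (⇑(uLower hM hML hNL χ f hf) : ℍ → ℂ) = ∑ j : Fin M, ⇑f ∣[k] tpB M ((j : ℕ) : ℤ) := by
  rw [← coe_uLevel L M k hM f]
  rfl

/-- **`U_M f` is `Γ₀(L)`-equivariant with the same character.** [cite: AtkinLehner1970, Lemma 7] -/
theorem uLower_slash_of_mem_gamma0 (hM : M.Prime) (hML : M ∣ L) {N : ℕ} [NeZero N] (hNL : N ∣ L)
    (χ : DirichletCharacter ℂ N) (f : ModularForm (Gamma1 (L * M)) k)
    (hf : ∀ γ : SL(2, ℤ), γ ∈ Gamma0 (L * M) → (⇑f : ℍ → ℂ) ∣[k] γ = χ ((γ 1 1 : ℤ) : ZMod N) • ⇑f)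
    {γ : SL(2, ℤ)} (hγ : γ ∈ Gamma0 L) :
    (⇑(uLower hM hML hNL χ f hf) : ℍ → ℂ) ∣[k] γ =
      χ ((γ 1 1 : ℤ) : ZMod N) • ⇑(uLower hM hML hNL χ f hf) := by
  rw [coe_uLower, ModularForm.SL_slash, sum_slash_tpB_slash hM hML hNL χ k ⇑f hf hγ]

/-- **The `q`-expansion of `U_M f`: `aₙ(U_M f) = a_{Mn}(f)`** (Diamond–Shurman, proof of
Prop. 5.2.2). [cite: DiamondShurman2005, Prop. 5.2.2 p. 172] -/
theorem qExpansion_coeff_uLower (hM : M.Prime) (hML : M ∣ L) {N : ℕ} [NeZero N] (hNL : N ∣ L)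
    (χ : DirichletCharacter ℂ N) (f : ModularForm (Gamma1 (L * M)) k)
    (hf : ∀ γ : SL(2, ℤ), γ ∈ Gamma0 (L * M) → (⇑f : ℍ → ℂ) ∣[k] γ = χ ((γ 1 1 : ℤ) : ZMod N) • ⇑f)
    (n : ℕ) :
    (qExpansion 1 ⇑(uLower hM hML hNL χ f hf)).coeff n = (qExpansion 1 ⇑f).coeff (M * n) := by
  haveI : NeZero (L * M) := ⟨mul_ne_zero (NeZero.ne L) (NeZero.ne M)⟩
  have h : ∀ τ : ℍ, HasSum (fun m ↦ (qExpansion 1 ⇑f).coeff (M * m) • Periodic.qParam 1 τ ^ m)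
      ((uLower hM hML hNL χ f hf) τ) := by
    intro τ
    have := hasSum_sum_slash_G_mul_T_zpow hM (val_tpG M) k (hasSum_qExpansion_Gamma1 (L * M) k f) τ
    rw [show ((uLower hM hML hNL χ f hf) τ) = (∑ j : Fin M, ⇑f ∣[k] tpB M ((j : ℕ) : ℤ)) τ by
      rw [← coe_uLower hM hML hNL χ f hf]]
    simpa only [tpB, Finset.sum_apply] using this
  exact (ModularFormClass.qExpansion_coeff_unique one_pos (one_mem_strictPeriods_Gamma1 L) h n).symm

end Operator

/-! ### Constant terms of `U_M f` along `SL₂(ℤ)` -/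

namespace ULower

variable (M : ℕ) [NeZero M]

/-- The matrix `γ'' = (a₀, b + jd; c, Md)` of the second factorisation `βⱼ γ = γ'' D` when
`a + jc = M a₀`. [folklore] -/
def gammaD (γ : SL(2, ℤ)) (j a₀ : ℤ) (ha : (M : ℤ) * a₀ = γ 0 0 + j * γ 1 0) : SL(2, ℤ) :=
  ⟨!![a₀, γ 0 1 + j * γ 1 1; γ 1 0, (M : ℤ) * γ 1 1], by
    have hdet := Matrix.SpecialLinearGroup.det_coe γ
    rw [Matrix.det_fin_two] at hdet
    rw [Matrix.det_fin_two_of]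
    linear_combination hdet + (γ 1 1) * ha⟩

/-- **The second factorisation** `βⱼ γ = γ'' diag(M, 1)` when `M ∣ a + jc`. [folklore] -/
theorem tpB_mul_eq_gammaD (γ : SL(2, ℤ)) (j a₀ : ℤ) (ha : (M : ℤ) * a₀ = γ 0 0 + j * γ 1 0) :
    tpB M j * (γ : GL (Fin 2) ℝ) = (gammaD M γ j a₀ ha : GL (Fin 2) ℝ) * tpD M := by
  ext i i'
  have ha' : (M : ℝ) * a₀ = γ 0 0 + j * γ 1 0 := by exact_mod_cast ha
  rw [Matrix.GeneralLinearGroup.coe_mul, Matrix.GeneralLinearGroup.coe_mul, val_tpB, val_tpD]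
  simp only [gammaD]
  fin_cases i <;> fin_cases i' <;>
    simp [Matrix.mul_apply, Fin.sum_univ_two] <;>
      first | ring1 | linear_combination -ha'

/-- Limit of `F ∣[k] βⱼ` at `i∞`: `M⁻¹ · lim F`. [folklore] -/
theorem tendsto_slash_tpB {F : ℍ → ℂ} {c : ℂ} (k : ℤ) (hF : Tendsto F atImInfty (𝓝 c))
    (j : ℤ) : Tendsto (F ∣[k] tpB M j) atImInfty (𝓝 ((M : ℂ)⁻¹ * c)) := by
  have h1 : (F ∣[k] tpB M j) = fun τ ↦ (M : ℂ)⁻¹ * F (tpB M j • τ) := by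
    funext τ
    exact slash_tpB_apply M k F j τ
  rw [h1]
  refine Tendsto.const_mul _ (hF.comp (UpperHalfPlane.tendsto_smul_atImInfty ?_))
  rw [val_tpB]
  simp

/-- Limit of `F ∣[k] diag(M, 1)` at `i∞`: `M^{k-1} · lim F`. [folklore] -/
theorem tendsto_slash_tpD {F : ℍ → ℂ} {c : ℂ} (k : ℤ) (hF : Tendsto F atImInfty (𝓝 c)) :
    Tendsto (F ∣[k] tpD M) atImInfty (𝓝 ((M : ℂ) ^ (k - 1) * c)) := by
  have h1 : (F ∣[k] tpD M) = fun τ ↦ (M : ℂ) ^ (k - 1) * F (tpD M • τ) := by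
    funext τ
    exact slash_tpD_apply M k F τ
  rw [h1]
  refine Tendsto.const_mul _ (hF.comp (UpperHalfPlane.tendsto_smul_atImInfty ?_))
  rw [val_tpD]
  simp

variable {M}

/-- **Constant terms of `U_M f` along `SL₂(ℤ)`.**  If `f ∣[k] γ → e χ(d_γ)` when `N ∣ c_γ`,
`M ∤ c_γ` and `→ 0` otherwise (all `γ ∈ SL₂(ℤ)`), then `(∑ⱼ f ∣[k] βⱼ) ∣[k] γ` tends to
`M^{k-1} χ(M) e χ(d_γ)` when `N ∣ c_γ`, `M ∤ c_γ`, and to `0` otherwise: for `M ∤ a + jc` one has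
`βⱼ γ = γ' β_{j'}` with `c_{γ'} = Mc` (limit `0`), and for the unique `j` with `M ∣ a + jc`
(which exists iff `M ∤ c`) `βⱼ γ = γ'' diag(M, 1)` with `(c, d)_{γ''} = (c, Md)`.
[cite: DiamondShurman2005, §5.2 (p. 170–172)] -/
theorem tendsto_sum_slash_tpB_atImInfty (hM : M.Prime) {N : ℕ} [NeZero N]
    (χ : DirichletCharacter ℂ N) (e : ℂ) (k : ℤ) (f : ℍ → ℂ)
    (hcf : ∀ γ : SL(2, ℤ), Tendsto (f ∣[k] γ) atImInfty
      (𝓝 (if (N : ℤ) ∣ γ 1 0 ∧ ¬ (M : ℤ) ∣ γ 1 0 then e * χ ((γ 1 1 : ℤ) : ZMod N) else 0)))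
    (γ : SL(2, ℤ)) :
    Tendsto ((∑ j : Fin M, f ∣[k] tpB M ((j : ℕ) : ℤ)) ∣[k] (γ : GL (Fin 2) ℝ)) atImInfty
      (𝓝 (if (N : ℤ) ∣ γ 1 0 ∧ ¬ (M : ℤ) ∣ γ 1 0 then
        (M : ℂ) ^ (k - 1) * χ (M : ZMod N) * e * χ ((γ 1 1 : ℤ) : ZMod N) else 0)) := by
  have hpz : Prime (M : ℤ) := Nat.prime_iff_prime_int.mp hM
  -- the limit of each term
  set ℓ : Fin M → ℂ := fun j ↦ if (M : ℤ) ∣ γ 0 0 + ((j : ℕ) : ℤ) * γ 1 0 then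
    (M : ℂ) ^ (k - 1) * (if (N : ℤ) ∣ γ 1 0 ∧ ¬ (M : ℤ) ∣ γ 1 0 then
      e * χ ((((M : ℤ) * γ 1 1 : ℤ)) : ZMod N) else 0) else 0 with hℓ
  have hterm : ∀ j : Fin M, Tendsto ((f ∣[k] tpB M ((j : ℕ) : ℤ)) ∣[k] (γ : GL (Fin 2) ℝ))
      atImInfty (𝓝 (ℓ j)) := by
    intro j
    rw [← SlashAction.slash_mul]
    by_cases hj : (M : ℤ) ∣ γ 0 0 + ((j : ℕ) : ℤ) * γ 1 0
    · -- second factorisation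
      obtain ⟨a₀, ha₀⟩ := hj
      rw [hℓ]
      dsimp only
      rw [if_pos ⟨a₀, ha₀⟩, tpB_mul_eq_gammaD M γ _ a₀ ha₀.symm, SlashAction.slash_mul,
        ← ModularForm.SL_slash]
      have h := hcf (gammaD M γ ((j : ℕ) : ℤ) a₀ ha₀.symm)
      exact tendsto_slash_tpD M k h
    · -- first factorisation
      obtain ⟨j', hj'⟩ := exists_fin_dvd_sub_mul hM hj (γ 0 1 + ((j : ℕ) : ℤ) * γ 1 1)
      obtain ⟨e', he'⟩ := hj'
      rw [hℓ]
      dsimp only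
      rw [if_neg hj, tpB_mul_eq M γ _ _ e' he'.symm, SlashAction.slash_mul, ← ModularForm.SL_slash]
      have h := hcf (gammaU M γ ((j : ℕ) : ℤ) ((j' : ℕ) : ℤ) e' he'.symm)
      have h0 : ¬ ((N : ℤ) ∣ (gammaU M γ ((j : ℕ) : ℤ) ((j' : ℕ) : ℤ) e' he'.symm) 1 0 ∧
          ¬ (M : ℤ) ∣ (gammaU M γ ((j : ℕ) : ℤ) ((j' : ℕ) : ℤ) e' he'.symm) 1 0) := by
        rintro ⟨-, h2⟩
        exact h2 ⟨γ 1 0, rfl⟩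
      rw [if_neg h0] at h
      have := tendsto_slash_tpB M k h ((j' : ℕ) : ℤ)
      rwa [mul_zero] at this
  rw [SlashAction.sum_slash]
  have hsum := tendsto_finsetSum (Finset.univ : Finset (Fin M)) fun j _ ↦ hterm j
  simp only [← Finset.sum_apply] at hsum
  convert hsum using 2
  -- ### the sum of the limits
  by_cases hMc : (M : ℤ) ∣ γ 1 0
  · -- no `j` with `M ∣ a + jc`
    rw [if_neg fun h ↦ h.2 hMc]
    symm
    refine Finset.sum_eq_zero fun j _ ↦ ?_
    rw [hℓ]
    dsimp only
    rw [if_neg (not_dvd_add_mul M hM hMc _)]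
  · -- exactly one `j₀`
    have hMc' : ¬ (M : ℤ) ∣ -γ 1 0 := fun h ↦ hMc (by simpa using h)
    obtain ⟨j₀, hj₀⟩ := exists_fin_dvd_sub_mul hM hMc' (γ 0 0)
    have hj₀' : (M : ℤ) ∣ γ 0 0 + ((j₀ : ℕ) : ℤ) * γ 1 0 := by
      simpa [sub_eq_add_neg, mul_neg] using hj₀
    rw [Finset.sum_eq_single j₀]
    · rw [hℓ]
      dsimp only
      rw [if_pos hj₀']
      by_cases hNc : (N : ℤ) ∣ γ 1 0
      · rw [if_pos ⟨hNc, hMc⟩, if_pos ⟨hNc, hMc⟩]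
        push_cast
        rw [map_mul]
        ring
      · rw [if_neg fun h ↦ hNc h.1, if_neg fun h ↦ hNc h.1, mul_zero]
    · intro j _ hj
      rw [hℓ]
      dsimp only
      rw [if_neg]
      intro hj'
      apply hj
      refine fin_eq_of_dvd_sub_mul hM hMc' (γ 0 0) ?_ hj₀
      simpa [sub_eq_add_neg, mul_neg] using hj'
    · intro h; exact absurd (Finset.mem_univ j₀) h

end ULower

/-- **Constant terms of the level-lowered form `U_M f`** (see
`ULower.tendsto_sum_slash_tpB_atImInfty`). [cite: DiamondShurman2005, §5.2] -/
theorem tendsto_uLower_slash_atImInfty {L M : ℕ} [NeZero L] [NeZero M] {k : ℤ} (hM : M.Prime)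
    (hML : M ∣ L) {N : ℕ} [NeZero N] (hNL : N ∣ L) (χ : DirichletCharacter ℂ N)
    (f : ModularForm (Gamma1 (L * M)) k)
    (hf : ∀ γ : SL(2, ℤ), γ ∈ Gamma0 (L * M) → (⇑f : ℍ → ℂ) ∣[k] γ = χ ((γ 1 1 : ℤ) : ZMod N) • ⇑f)
    (e : ℂ)
    (hcf : ∀ γ : SL(2, ℤ), Tendsto ((⇑f : ℍ → ℂ) ∣[k] γ) atImInfty
      (𝓝 (if (N : ℤ) ∣ γ 1 0 ∧ ¬ (M : ℤ) ∣ γ 1 0 then e * χ ((γ 1 1 : ℤ) : ZMod N) else 0)))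
    (γ : SL(2, ℤ)) :
    Tendsto ((⇑(uLower hM hML hNL χ f hf) : ℍ → ℂ) ∣[k] γ) atImInfty
      (𝓝 (if (N : ℤ) ∣ γ 1 0 ∧ ¬ (M : ℤ) ∣ γ 1 0 then
        (M : ℂ) ^ (k - 1) * χ (M : ZMod N) * e * χ ((γ 1 1 : ℤ) : ZMod N) else 0)) := by
  rw [coe_uLower, ModularForm.SL_slash]
  exact ULower.tendsto_sum_slash_tpB_atImInfty hM χ e k ⇑f hcf γ

end Literature.NumberTheory.EllipticCurves.ModularForms
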